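import Mathlib
import Literature.Analysis.OperatorTheory.RieszProjectionContour
import Literature.Analysis.OperatorTheory.RieszProjectionPerturbation
import Literature.Analysis.OperatorTheory.RieszProjectionIdempotent
import Literature.Analysis.OperatorTheory.PairOfProjections
import Literature.Analysis.OperatorTheory.RieszProjectionCompact
import HarnessLib

/-!
# Crux `MayerPairing.BranchPairing` (stmt-RiemannHypothesis-1471), line `weinstein-aronszajn-pinning`:
spectral slices in a resolvent tube (STUB 2a, `tubeSpectrumData_main`)

Route `RiemannHypothesis/MayerPairing`, crux `BranchPairing` (item stmt-RiemannHypothesis-1471), line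
`weinstein-aronszajn-pinning`; supports 1471. This file proves the registered sub-goal
`tubeSpectrumData_main` = the expanded form of the stub `stub_tubeSpectrumData : TubeSpectrumData`
of the checked skeleton: for a norm-continuous family `σ ↦ T σ` of compact operators on a complex
Banach space over `[a, b]`, a continuous radius `0 < δ σ < 1` whose circle `‖μ − 1‖ = δ σ` never
meets `spec (T σ)`, and one spectral point inside at `σ = a`, the slices
`S σ = spec (T σ) ∩ ball 1 (δ σ)` are (i) non-empty for every `σ`, (ii) finite of uniformly
bounded cardinality, (iii) of closed graph over `[a, b]`, (iv) lower semicontinuous. The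
statement is ζ-free and Mayer-free (Kato 1966, IV-§3.4 Thm. 3.16, IV-§3.5, III-§6.7 Thm. 6.26,
I-§4.6 Lemma 4.10).

Mechanism. `P σ := rieszProjection (T σ) 1 (δ σ)` (Literature `RieszProjectionContour`) is an
idempotent (`rieszProjection_mul_self`), norm-continuous on `[a, b]` although the circle moves
(`continuousWithinAt_rieszProjection_of_radius`), compact with finite-dimensional range because
`T σ` is compact and the circle does not enclose `0` (`finiteDimensional_range_rieszProjection`),
so `dim range (P σ)` is constant on the connected `[a, b]` (Kato I-§4.6 Lemma 4.10,
`PairOfProjections.finrank_range_eq_of_isPreconnected`) and positive (an eigenvector inside at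
`σ = a` is fixed by `P a`). Hence (i) `P σ ≠ 0`, which forces spectrum inside
(`spectrum_inter_ball_nonempty_of_rieszProjection_ne_zero`); (ii) `#S σ ≤ dim range (P σ)`
(`exists_finset_eq_spectrum_inter_ball`: independent eigenvectors in the range); (iii) joint
openness of `{(A, z) | z ∈ ρ(A)}` (`isOpen_setOf_mem_resolventSet`) plus the excluded circle;
(iv) a point `μ₀ ∈ S σ₀` is an eigenvalue isolated in the finite slice, so a small circle around
it lies in `ρ(T σ₀)` and the eigenvalue persists inside it under small norm perturbations
(`eventually_spectrum_inter_ball_nonempty_of_apply_eq_smul`).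
-/

noncomputable section

namespace Summit.RiemannHypothesis.RiemannHypothesis.Theorems.MayerPairingPinning

open Set Metric Filter Topology Literature.Analysis.OperatorTheory

/-- **Spectral slices in a resolvent tube** (registered sub-goal `tubeSpectrumData_main` of
stmt-RiemannHypothesis-1471 = the expanded form of STUB 2a `stub_tubeSpectrumData`). For a
norm-continuous family `σ ↦ T σ` of compact operators on a complex Banach space over `[a, b]`, a
continuous radius `0 < δ σ < 1` whose circle `‖μ − 1‖ = δ σ` never meets `spec (T σ)`, and one
spectral point inside at `σ = a`, the slices `S σ = spec (T σ) ∩ ball 1 (δ σ)` are (i) non-empty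
for every `σ ∈ [a, b]`, (ii) finite of uniformly bounded cardinality, (iii) of closed graph over
`[a, b]`, and (iv) lower semicontinuous (Kato 1966, IV-§3.4 Thm. 3.16 and §3.5, III-§6.7
Thm. 6.26, I-§4.6 Lemma 4.10). -/
theorem tubeSpectrumData_main : ∀ (E : Type) [NormedAddCommGroup E] [NormedSpace ℂ E] [CompleteSpace E] (T : ℝ → (E →L[ℂ] E)) (δ : ℝ → ℝ) (a b : ℝ), a ≤ b → ContinuousOn T (Set.Icc a b) → ContinuousOn δ (Set.Icc a b) → (∀ σ ∈ Set.Icc a b, IsCompactOperator (T σ)) → (∀ σ ∈ Set.Icc a b, 0 < δ σ ∧ δ σ < 1) → (∀ σ ∈ Set.Icc a b, ∀ μ : ℂ, ‖μ - 1‖ = δ σ → μ ∉ spectrum ℂ (T σ)) → (∃ μ ∈ spectrum ℂ (T a), ‖μ - 1‖ < δ a) → (∀ σ ∈ Set.Icc a b, (spectrum ℂ (T σ) ∩ Metric.ball 1 (δ σ)).Nonempty) ∧ (∃ n : ℕ, ∀ σ ∈ Set.Icc a b, ∃ F : Finset ℂ, (↑F : Set ℂ) = spectrum ℂ (T σ)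 ∩ Metric.ball 1 (δ σ) ∧ F.card ≤ n) ∧ IsClosed {p : ℝ × ℂ | p.1 ∈ Set.Icc a b ∧ p.2 ∈ spectrum ℂ (T p.1) ∩ Metric.ball 1 (δ p.1)} ∧ (∀ σ₀ ∈ Set.Icc a b, ∀ μ₀ ∈ spectrum ℂ (T σ₀) ∩ Metric.ball 1 (δ σ₀), ∀ ε > (0 : ℝ), ∃ η > (0 : ℝ), ∀ σ ∈ Set.Icc a b, |σ - σ₀| < η → ∃ μ ∈ spectrum ℂ (T σ) ∩ Metric.ball 1 (δ σ), ‖μ - μ₀‖ < ε) := by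
  intro E _ _ _ T δ a b hab hT hδ hc h01 hcirc hspec
  -- the circles lie in the resolvent sets and do not enclose `0`
  have hsph : ∀ σ ∈ Icc a b, sphere (1 : ℂ) (δ σ) ⊆ resolventSet ℂ (T σ) := fun σ hσ z hz =>
    by_contra fun h => hcirc σ hσ z (mem_sphere_iff_norm.1 hz) h
  have hlt1 : ∀ σ ∈ Icc a b, δ σ < ‖(1 : ℂ)‖ := fun σ hσ => by
    rw [norm_one]
    exact (h01 σ hσ).2
  -- the Riesz projections `P σ = rieszProjection (T σ) 1 (δ σ)`: idempotent, continuous on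
  -- `[a, b]`, of constant finite positive rank
  have hPid : ∀ σ ∈ Icc a b, rieszProjection (T σ) 1 (δ σ) * rieszProjection (T σ) 1 (δ σ) =
      rieszProjection (T σ) 1 (δ σ) := fun σ hσ =>
    rieszProjection_mul_self (h01 σ hσ).1 (hsph σ hσ)
  have hPcont : ContinuousOn (fun σ => rieszProjection (T σ) 1 (δ σ)) (Icc a b) := fun σ hσ =>
    continuousWithinAt_rieszProjection_of_radius (hT σ hσ) (hδ σ hσ) (h01 σ hσ).1 (hsph σ hσ)
  have ha : a ∈ Icc a b := left_mem_Icc.2 hab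
  set n : ℕ := Module.finrank ℂ (LinearMap.range (↑(rieszProjection (T a) 1 (δ a)) : E →ₗ[ℂ] E))
    with hn
  have hrank : ∀ σ ∈ Icc a b,
      Module.finrank ℂ (LinearMap.range (↑(rieszProjection (T σ) 1 (δ σ)) : E →ₗ[ℂ] E)) = n :=
    fun σ hσ => PairOfProjections.finrank_range_eq_of_isPreconnected isPreconnected_Icc
      (P := fun σ => rieszProjection (T σ) 1 (δ σ)) hPcont hPid hσ ha
  have hn0 : 0 < n := by
    haveI := finiteDimensional_range_rieszProjection (hc a ha) (h01 a ha).1 (hsph a ha) (hlt1 a ha)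
    obtain ⟨μ, hμ, hμa⟩ := hspec
    have hμ0 : μ ≠ 0 := by
      rintro rfl
      rw [zero_sub, norm_neg, norm_one] at hμa
      linarith [(h01 a ha).2]
    obtain ⟨v, hv0, hv⟩ :=
      exists_eigenvector_of_mem_spectrum_of_isCompactOperator (hc a ha) hμ hμ0
    have hPa : rieszProjection (T a) 1 (δ a) ≠ 0 :=
      rieszProjection_ne_zero_of_apply_eq_smul hv hv0 (by rwa [mem_ball, dist_eq_norm]) (hsph a ha)
    refine Nat.pos_of_ne_zero fun h0 => hPa ?_
    have h1 := Submodule.finrank_eq_zero.1 h0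
    rw [LinearMap.range_eq_bot] at h1
    exact ContinuousLinearMap.coe_injective h1
  have hPne : ∀ σ ∈ Icc a b, rieszProjection (T σ) 1 (δ σ) ≠ 0 := fun σ hσ h0 => by
    have h1 := hrank σ hσ
    rw [h0, ContinuousLinearMap.toLinearMap_zero, LinearMap.range_zero, finrank_bot] at h1
    exact hn0.ne h1
  -- (i) non-emptiness
  have h_i : ∀ σ ∈ Icc a b, (spectrum ℂ (T σ) ∩ ball 1 (δ σ)).Nonempty := fun σ hσ =>
    spectrum_inter_ball_nonempty_of_rieszProjection_ne_zero (h01 σ hσ).1.le (hsph σ hσ)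
      (hPne σ hσ)
  -- (ii) uniform finiteness: `#S σ ≤ dim range (P σ) = n`
  have h_ii : ∃ n : ℕ, ∀ σ ∈ Icc a b, ∃ F : Finset ℂ,
      (↑F : Set ℂ) = spectrum ℂ (T σ) ∩ ball 1 (δ σ) ∧ F.card ≤ n := by
    refine ⟨n, fun σ hσ => ?_⟩
    obtain ⟨F, hF, hFc⟩ :=
      exists_finset_eq_spectrum_inter_ball (hc σ hσ) (h01 σ hσ).1 (hsph σ hσ) (hlt1 σ hσ)
    exact ⟨F, hF, hFc.trans (hrank σ hσ).le⟩
  -- (iii) closed graph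
  have h_iii : IsClosed {p : ℝ × ℂ | p.1 ∈ Icc a b ∧
      p.2 ∈ spectrum ℂ (T p.1) ∩ ball 1 (δ p.1)} := by
    have hF : IsClosed {q : (E →L[ℂ] E) × ℂ × ℝ | q.2.1 ∈ spectrum ℂ q.1 ∧ dist q.2.1 1 ≤ q.2.2} := by
      refine IsClosed.inter ?_ (isClosed_le ((continuous_fst.comp continuous_snd).dist
        continuous_const) (continuous_snd.comp continuous_snd))
      have ho : IsOpen ((fun q : (E →L[ℂ] E) × ℂ × ℝ => (q.1, q.2.1)) ⁻¹'
          {p : (E →L[ℂ] E) × ℂ | p.2 ∈ resolventSet ℂ p.1}) :=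
        isOpen_setOf_mem_resolventSet.preimage
          (continuous_fst.prodMk (continuous_fst.comp continuous_snd))
      exact ho.isClosed_compl
    have hf : ContinuousOn (fun p : ℝ × ℂ => (T p.1, p.2, δ p.1)) (Icc a b ×ˢ univ) :=
      (hT.comp continuousOn_fst fun p hp => hp.1).prodMk
        (continuousOn_snd.prodMk (hδ.comp continuousOn_fst fun p hp => hp.1))
    have heq : {p : ℝ × ℂ | p.1 ∈ Icc a b ∧ p.2 ∈ spectrum ℂ (T p.1) ∩ ball 1 (δ p.1)} =
        Icc a b ×ˢ univ ∩ (fun p : ℝ × ℂ => (T p.1, p.2, δ p.1)) ⁻¹'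
          {q | q.2.1 ∈ spectrum ℂ q.1 ∧ dist q.2.1 1 ≤ q.2.2} := by
      ext ⟨σ, μ⟩
      simp only [mem_setOf_eq, mem_inter_iff, mem_prod, mem_univ, and_true, mem_preimage, mem_ball]
      constructor
      · rintro ⟨hσ, hμ, hlt⟩
        exact ⟨hσ, hμ, hlt.le⟩
      · rintro ⟨hσ, hμ, hle⟩
        refine ⟨hσ, hμ, lt_of_le_of_ne hle fun h => hcirc σ hσ μ ?_ hμ⟩
        rwa [dist_eq_norm] at h
    rw [heq]
    exact hf.preimage_isClosed_of_isClosed (isClosed_Icc.prod isClosed_univ) hF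
  -- (iv) lower semicontinuity
  have h_iv : ∀ σ₀ ∈ Icc a b, ∀ μ₀ ∈ spectrum ℂ (T σ₀) ∩ ball 1 (δ σ₀), ∀ ε > (0 : ℝ),
      ∃ η > (0 : ℝ), ∀ σ ∈ Icc a b, |σ - σ₀| < η →
        ∃ μ ∈ spectrum ℂ (T σ) ∩ ball 1 (δ σ), ‖μ - μ₀‖ < ε := by
    intro σ₀ hσ₀ μ₀ hμ₀ ε hε
    have hd : dist μ₀ 1 < δ σ₀ := mem_ball.1 hμ₀.2
    -- `μ₀ ≠ 0` is an eigenvalue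
    have hμ00 : μ₀ ≠ 0 := by
      rintro rfl
      rw [dist_eq_norm, zero_sub, norm_neg, norm_one] at hd
      linarith [(h01 σ₀ hσ₀).2]
    obtain ⟨v, hv0, hv⟩ :=
      exists_eigenvector_of_mem_spectrum_of_isCompactOperator (hc σ₀ hσ₀) hμ₀.1 hμ00
    -- `μ₀` is isolated in the (finite) slice
    have hfin : (spectrum ℂ (T σ₀) ∩ ball 1 (δ σ₀)).Finite :=
      finite_spectrum_inter_ball_of_isCompactOperator (hc σ₀ hσ₀) (h01 σ₀ hσ₀).1 (hsph σ₀ hσ₀)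
        (hlt1 σ₀ hσ₀)
    obtain ⟨r₀, hr₀, hball⟩ : ∃ r₀ > 0,
        ball μ₀ r₀ ⊆ ((spectrum ℂ (T σ₀) ∩ ball 1 (δ σ₀)) \ {μ₀})ᶜ :=
      Metric.mem_nhds_iff.1 ((hfin.subset sdiff_subset).isClosed.isOpen_compl.mem_nhds (by simp))
    -- a small circle around `μ₀` in the resolvent set, inside the tube, of radius `< ε`
    set g : ℝ := δ σ₀ - dist μ₀ 1 with hg
    have hg0 : 0 < g := by linarith
    set r : ℝ := min (r₀ / 2) (min (ε / 2) (g / 2)) with hr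
    have hr0 : 0 < r := lt_min (by linarith) (lt_min (by linarith) (by linarith))
    have hrr₀ : r < r₀ := (min_le_left _ _).trans_lt (by linarith)
    have hrε : r < ε := ((min_le_right _ _).trans (min_le_left _ _)).trans_lt (by linarith)
    have hrg : r ≤ g / 2 := (min_le_right _ _).trans (min_le_right _ _)
    have hsr : sphere μ₀ r ⊆ resolventSet ℂ (T σ₀) := by
      intro z hz
      by_contra hzρ
      have hz1 : dist z 1 < δ σ₀ := by
        calc dist z 1 ≤ dist z μ₀ + dist μ₀ 1 := dist_triangle _ _ _
          _ = r + dist μ₀ 1 := by rw [mem_sphere.1 hz]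
          _ < δ σ₀ := by linarith
      have hzμ : z ≠ μ₀ := by
        intro h
        rw [h, mem_sphere, dist_self] at hz
        linarith
      have hzball : z ∈ ball μ₀ r₀ := mem_ball.2 (by rw [mem_sphere.1 hz]; linarith)
      exact hball hzball ⟨⟨hzρ, mem_ball.2 hz1⟩, hzμ⟩
    -- persistence of the eigenvalue inside the small circle
    have h1 : ∀ᶠ S' in 𝓝 (T σ₀), (spectrum ℂ S' ∩ ball μ₀ r).Nonempty :=
      eventually_spectrum_inter_ball_nonempty_of_apply_eq_smul hv hv0 (mem_ball_self hr0) hsr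
    have h2 : ∀ᶠ σ in 𝓝[Icc a b] σ₀, (spectrum ℂ (T σ) ∩ ball μ₀ r).Nonempty :=
      (hT σ₀ hσ₀).tendsto.eventually h1
    have h3 : ∀ᶠ σ in 𝓝[Icc a b] σ₀, dist (δ σ) (δ σ₀) < g / 2 :=
      Metric.tendsto_nhds.1 (hδ σ₀ hσ₀) _ (by linarith)
    have h4 : ∀ᶠ σ in 𝓝[Icc a b] σ₀, ∃ μ ∈ spectrum ℂ (T σ) ∩ ball 1 (δ σ), ‖μ - μ₀‖ < ε := by
      filter_upwards [h2, h3] with σ hσ2 hσ3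
      obtain ⟨μ, hμs, hμb⟩ := hσ2
      rw [mem_ball] at hμb
      rw [Real.dist_eq, abs_sub_lt_iff] at hσ3
      refine ⟨μ, ⟨hμs, mem_ball.2 ?_⟩, ?_⟩
      · calc dist μ 1 ≤ dist μ μ₀ + dist μ₀ 1 := dist_triangle _ _ _
          _ < r + dist μ₀ 1 := by linarith
          _ < δ σ := by linarith
      · rw [← dist_eq_norm]
        linarith
    obtain ⟨η, hη, hsub⟩ := Metric.mem_nhdsWithin_iff.1 h4
    refine ⟨η, hη, fun σ hσ hσσ₀ => hsub ⟨?_, hσ⟩⟩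
    rw [mem_ball, Real.dist_eq]
    exact hσσ₀
  exact ⟨h_i, h_ii, h_iii, h_iv⟩

end Summit.RiemannHypothesis.RiemannHypothesis.Theorems.MayerPairingPinning

end
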